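import Mathlib

/-!
# `ChargedEnergyGap` — the TWIN TREE: Σ3ⁿ backtracking (the edge lemma) and the tree theorem
# (cell `decomp-a2c`, lens 3, generation 57, node «TwinTree», part P-E(1/2); SUPPORT beneath (N𝄪) of part P-D `…Theorems.ChargedEnergyGapLocalTransfer`;
# companion P-E(2/2) `…Theorems.ChargedEnergyGapTwinRigidity` — two-system rigidity and wedge crossing)

WHAT P-D LEFT (memo g56 §2/§4, critic row 1075 (iv)): the reduction (N𝄪) `LocalSeamReductionW` is proved ON PAPER through three
metric-free lemmas — the EDGE LEMMA (a closed walk through gross-free Σ3-twinned matter backtracks in the Σ3ⁿ orientation tree, so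
coherent faces and stacking seams are COMPLETE planes), the TWO-SYSTEM RIGIDITY LEMMA and the WEDGE-CROSSING COROLLARY (companion
file).  The critic's ruling: «when (N𝄪) is typed toward proof its first Lean deliverable is that lemma over the abstract Σ3ⁿ orientation
groupoid (free-group backtracking), before any metric constant».  THIS FILE IS THAT DELIVERABLE, fully proved, tower-independent
(`import Mathlib` only), in the lineage namespace; it adds NO hypothesis, NO datum, NO dial; the record `(ϱχ, Cχ) = (80, 10⁻⁵)` with
`(μ₀, τ, λ, b₀, r_S, C_T) = (1/100, 3/100, 1/2, 2/5, 3, 1/(3·10⁶))` and the residual of record (census asks χCOST-56 / GROSS-56) are unchanged.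

THE DICTIONARY (orientation walk ↦ axis word; bookkeeping inside (N𝄪)'s proof, not a new piece).
 * Crystal frame of the reference fcc grain; its four {111} systems are labelled by `a : Fin 4` with primitive normal `twinAxis a ∈ ℤ³`
   (`(1,1,1), (1,−1,−1), (−1,1,−1), (−1,−1,1)`; Gram table `3 / −1`, `twinAxis_dotProduct`).
 * Crossing a COHERENT Σ3 face of system `a` multiplies the orientation (a coset `g·O`, `O` the proper cubic point group) on the right
   by the twin operation `twinRot a = (1/3)(2·a aᵀ − 3·1)`, the rotation by `π` about `⟨111⟩_a` (`twinRot_mul_self`,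
   `twinRot_mul_transpose`, `twinRot_det`, `twinRot_mulVec_axis`, `twinRot_mulVec_of_orth`) — the 60°⟨111⟩ = 70.53°⟨110⟩ Σ3
   misorientation modulo `O` (the letters `a b c d` of Reed et al.).  Choosing the frame of each successive grain as
   (previous frame)·`twinRot a` — allowed, an orientation is a coset — a walk crossing faces of systems `a₁, …, aₙ` (each letter read
   in the frame of the grain being left) ends in the frame `g₀ · twinRot a₁ ⋯ twinRot aₙ`; two consecutive letters are EQUAL iff the two
   faces bounding that grain are parallel twin planes of one system (a twin lamella: BACKTRACKING); the walk CLOSES iff the product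
   lies in `O ⊂ GL₃(ℤ)`, in particular only if it is an INTEGRAL matrix (`integralMatrices`, `mapMatrix_mem_integralMatrices`).
 * (T) ALGEBRA.  Mod `3` the numerator `3·twinRot a` is the rank-one matrix `−a aᵀ` (`2 ≡ −1`; `twinNum₃_eq`) and distinct axes have
   `a·b ≡ −1`; so over a NON-BACKTRACKING word the numerators telescope to `−(first axis)(last axis)ᵀ (mod 3)`
   (`prod_map_twinNum₃_cons`), none of whose entries vanishes: the product of `n ≥ 1` twin operations along a non-backtracking word
   has exact denominator `3ⁿ` (`Σ = 3ⁿ`) and is NEVER integral (`prod_map_twinRot_not_mem`).  Hence ★★ the EDGE LEMMA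
   `exists_adjacent_eq_of_prod_mem` / `exists_adjacent_eq_of_prod_eq_mapMatrix` (closed ⇒ backtracks; corollaries `twinRot_not_mem`:
   a coherent twin plane cannot END in defect-free matter; `twinRot_mul_twinRot_not_mem`: `Σ3·Σ3' = Σ9`, two crossing systems need
   a third, non-Σ3 boundary; fivefold twins `ababa` never close — the 7.35° gap) and ★★ the TREE THEOREM
   `eq_of_prod_map_twinRot_mul_eq` (reduced words label the reachable orientation classes injectively: the classes form the
   `4·3ⁿ⁻¹`-branching Cayley tree of `(ℤ/2)^{*4}` — the Σ3^ω structure of Reed et al. (2004) / Cayron (2007), here PROVED faithful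
   modulo every integral matrix at once by the mod-3 identity).
HOW (N𝄪)'S PROOF CONSUMES IT (memo g57 §2).  (E1) around a line `e` in gross-free weighted matter the faces meeting at `e` give a
closed walk ⇒ `exists_adjacent_eq_of_prod_eq_mapMatrix` ⇒ two consecutive faces through one sector are parallel planes of one system
containing `e` ⇒ one plane, `e` not an edge of it ⇒ (induction on the number of faces) faces and seams are complete planes; (E2) the
tree theorem makes the «tree distance» of carved orientation classes well defined (Σ9 = distance 2, …), which the class convention of
memo g56 §4 orders by.  The PHYSICAL inputs (junction lines, tips, Σ9 contacts, fivefold axes are gross) remain the census ask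
GROSS-56; nothing here pre-empts χCOST-56.

TAGS.  (T): SUPPORT, PROVED (0 sorry; no `def … : Prop`, no instance, no axiom; axioms of `eq_of_prod_map_twinRot_mul_eq` =
{propext, Classical.choice, Quot.sound}), beneath (N𝄪) `LocalSeamReductionW` [WEAKER than (Nˢ); UNDECIDED·ATTACKABLE-L]; (H𝄪)
`LocalSeamTransferBoundC` [UNDECIDED·INSTRUMENTABLE ← χCOST-56] untouched.  PRIOR ART (memo g57 §3, corpus + galaxy): the string
calculus `abbcd = acd` and the free structure Σ3^ω are Reed–Minich–Rudd–Kumar (Acta Cryst. A60, 2004) and Reed–Kumar (2006); the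
groupoid / tetrahedral fractal and `N(n) = 4·3ⁿ` are Cayron (Acta Cryst. A63, 2007; arXiv:1810.07613 §6), who records that the group
«is rarely defined completely and its properties are not always demonstrated».  WHAT IS NEW HERE is the certificate only: a
kernel-checked proof of faithfulness by the mod-3 rank-one telescoping (`2 ≡ −1`, `a·b ≡ −1`), stated over all integral matrices at once
— the first Lean deliverable the critic asked of (N𝄪).
-/

open Matrix

namespace Summit.AtomisticToContinuum.Crystallization.Theorems.ChargedEnergyGapChartDial


section TwinTree

/-! ### (T1) The four Σ3 twin operations of the cubic reference crystal -/

/-- The four `⟨111⟩` AXES of the cubic reference crystal as primitive integer vectors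
`(1,1,1), (1,−1,−1), (−1,1,−1), (−1,−1,1)` — one per `{111}` plane system (pairwise dot product `−1`, norm² `3`). -/
def twinAxis : Fin 4 → Fin 3 → ℤ :=
  ![![1, 1, 1], ![1, -1, -1], ![-1, 1, -1], ![-1, -1, 1]]

/-- Gram table of the axes: `3` on the diagonal, `−1` off it. -/
theorem twinAxis_dotProduct (a b : Fin 4) :
    twinAxis a ⬝ᵥ twinAxis b = if a = b then 3 else -1 := by
  fin_cases a <;> fin_cases b <;> simp [twinAxis, dotProduct, Fin.sum_univ_three]

/-- The NUMERATOR of the twin operation of system `a`: `3·R_a = 2·a aᵀ − 3·1`, an integer matrix. -/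
def twinNum (a : Fin 4) : Matrix (Fin 3) (Fin 3) ℤ :=
  (2 : ℤ) • vecMulVec (twinAxis a) (twinAxis a) - (3 : ℤ) • (1 : Matrix (Fin 3) (Fin 3) ℤ)

/-- The Σ3 TWIN OPERATION of system `a` in the crystal frame: `R_a = (1/3)·(2·a aᵀ − 3·1)`, entrywise
`(R_a)ᵢⱼ = (2/3)·aᵢaⱼ − δᵢⱼ` — the rotation by `π` about `⟨111⟩_a` (equivalently, modulo the cubic point group, the
`60°⟨111⟩` / `70.53°⟨110⟩` Σ3 misorientation). -/
def twinRot (a : Fin 4) : Matrix (Fin 3) (Fin 3) ℚ :=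
  (1 / 3 : ℚ) • (Int.castRingHom ℚ).mapMatrix (twinNum a)

/-- Rank-one products telescope through the dot product: `(a bᵀ)(c dᵀ) = (b·c)·(a dᵀ)`. -/
theorem vecMulVec_mul_vecMulVec' {n : Type*} [Fintype n] {R : Type*} [CommRing R] (a b c d : n → R) :
    vecMulVec a b * vecMulVec c d = (b ⬝ᵥ c) • vecMulVec a d := by
  ext i j
  simp only [mul_apply, vecMulVec_apply, Matrix.smul_apply, dotProduct, smul_eq_mul, Finset.sum_mul]
  exact Finset.sum_congr rfl fun x _ => by ring

/-- `(3 R_a)² = 9·1`. -/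
theorem twinNum_mul_self (a : Fin 4) :
    twinNum a * twinNum a = (9 : ℤ) • (1 : Matrix (Fin 3) (Fin 3) ℤ) := by
  fin_cases a <;> decide

/-- `3 R_a` is symmetric. -/
theorem twinNum_transpose (a : Fin 4) : (twinNum a)ᵀ = twinNum a := by
  fin_cases a <;> decide

/-- `det (3 R_a) = 27`, i.e. `det R_a = +1`: `R_a` is a proper rotation. -/
theorem twinNum_det (a : Fin 4) : (twinNum a).det = 27 := by
  fin_cases a <;> decide

/-- `3 R_a` fixes the axis up to the factor `3` … -/
theorem twinNum_mulVec_axis (a : Fin 4) : twinNum a *ᵥ twinAxis a = (3 : ℤ) • twinAxis a := by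
  fin_cases a <;> decide

/-- … and acts as `−3` on the integer vectors orthogonal to the axis. -/
theorem twinNum_mulVec_of_orth (a : Fin 4) (v : Fin 3 → ℤ) (hv : twinAxis a ⬝ᵥ v = 0) :
    twinNum a *ᵥ v = -((3 : ℤ) • v) := by
  have h1 : vecMulVec (twinAxis a) (twinAxis a) *ᵥ v = 0 := by
    funext i
    have : (vecMulVec (twinAxis a) (twinAxis a) *ᵥ v) i = twinAxis a i * (twinAxis a ⬝ᵥ v) := by
      simp only [mulVec, dotProduct, vecMulVec_apply, Finset.mul_sum, mul_assoc]
    rw [this, hv, mul_zero, Pi.zero_apply]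
  rw [twinNum, Matrix.sub_mulVec, Matrix.smul_mulVec, Matrix.smul_mulVec, h1, smul_zero, Matrix.one_mulVec,
    zero_sub]

/-- `R_a` is an involution: crossing the same coherent twin plane twice returns the orientation. -/
theorem twinRot_mul_self (a : Fin 4) : twinRot a * twinRot a = 1 := by
  rw [twinRot, Matrix.smul_mul, Matrix.mul_smul, smul_smul, ← map_mul, twinNum_mul_self, map_zsmul, map_one,
    ← Int.cast_smul_eq_zsmul ℚ (9 : ℤ), smul_smul]
  norm_num

/-- `R_a` is symmetric … -/
theorem twinRot_transpose (a : Fin 4) : (twinRot a)ᵀ = twinRot a := by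
  rw [twinRot, transpose_smul, RingHom.mapMatrix_apply, ← transpose_map, twinNum_transpose]

/-- … hence orthogonal: `R_a R_aᵀ = 1`. -/
theorem twinRot_mul_transpose (a : Fin 4) : twinRot a * (twinRot a)ᵀ = 1 := by
  rw [twinRot_transpose, twinRot_mul_self]

/-- … and proper: `det R_a = 1` (a rotation, the `180°⟨111⟩_a` description of the Σ3 twin). -/
theorem twinRot_det (a : Fin 4) : (twinRot a).det = 1 := by
  rw [twinRot, det_smul, ← RingHom.map_det, twinNum_det, Fintype.card_fin]
  norm_num

/-- Transport of the integer action to `ℚ`: `R_a v = (1/3)·(3R_a) v` on integer vectors. -/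
theorem twinRot_mulVec_intCast (a : Fin 4) (v : Fin 3 → ℤ) :
    twinRot a *ᵥ (fun i => (v i : ℚ)) = fun i => (1 / 3 : ℚ) * ((twinNum a *ᵥ v) i : ℤ) := by
  funext i
  rw [twinRot, Matrix.smul_mulVec, Pi.smul_apply, smul_eq_mul, RingHom.mapMatrix_apply,
    show (fun i => (v i : ℚ)) = (Int.castRingHom ℚ) ∘ v from rfl, ← RingHom.map_mulVec]
  rfl

/-- `R_a` fixes its own axis: the twin of system `a` shares the plane `{111}_a` with its parent (the coherent
twin plane is invariant). -/
theorem twinRot_mulVec_axis (a : Fin 4) :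
    twinRot a *ᵥ (fun i => (twinAxis a i : ℚ)) = fun i => (twinAxis a i : ℚ) := by
  rw [twinRot_mulVec_intCast, twinNum_mulVec_axis]
  funext i
  simp only [Pi.smul_apply, smul_eq_mul]
  push_cast
  ring

/-- `R_a` reverses every (integer) vector orthogonal to its axis: it is the rotation by `π` about `⟨111⟩_a`. -/
theorem twinRot_mulVec_of_orth (a : Fin 4) (v : Fin 3 → ℤ) (hv : twinAxis a ⬝ᵥ v = 0) :
    twinRot a *ᵥ (fun i => (v i : ℚ)) = fun i => -(v i : ℚ) := by
  rw [twinRot_mulVec_intCast, twinNum_mulVec_of_orth a v hv]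
  funext i
  simp only [Pi.neg_apply, Pi.smul_apply, smul_eq_mul]
  push_cast
  ring

/-! ### (T2) Reduction mod 3: products over non-backtracking axis words -/

/-- The axes mod `3`. -/
def twinAxis₃ (a : Fin 4) : Fin 3 → ZMod 3 := fun i => (twinAxis a i : ZMod 3)

/-- The numerators mod `3`. -/
def twinNum₃ (a : Fin 4) : Matrix (Fin 3) (Fin 3) (ZMod 3) :=
  (Int.castRingHom (ZMod 3)).mapMatrix (twinNum a)

/-- Mod `3` the numerator is the rank-one matrix `−a aᵀ` (`2 ≡ −1`, `3 ≡ 0`). -/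
theorem twinNum₃_eq (a : Fin 4) : twinNum₃ a = -vecMulVec (twinAxis₃ a) (twinAxis₃ a) := by
  fin_cases a <;> decide

/-- Distinct axes have dot product `−1 (mod 3)`. -/
theorem twinAxis₃_dotProduct_of_ne : ∀ a b : Fin 4, a ≠ b → twinAxis₃ a ⬝ᵥ twinAxis₃ b = -1 := by
  decide

/-- No axis coordinate vanishes mod `3`. -/
theorem twinAxis₃_apply_ne_zero : ∀ (a : Fin 4) (i : Fin 3), twinAxis₃ a i ≠ 0 := by
  decide

/-- KEY TELESCOPING IDENTITY. Over a word `a :: w` with no two adjacent letters equal (a non-backtracking walk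
across coherent twin planes) the product of the numerators is, mod `3`, the rank-one matrix
`−(first axis)(last axis)ᵀ`. -/
theorem prod_map_twinNum₃_cons (a : Fin 4) (w : List (Fin 4)) (hc : (a :: w).IsChain (· ≠ ·)) :
    ((a :: w).map twinNum₃).prod =
      -vecMulVec (twinAxis₃ a) (twinAxis₃ ((a :: w).getLast (List.cons_ne_nil a w))) := by
  induction w generalizing a with
  | nil => simpa using twinNum₃_eq a
  | cons b w ih =>
    obtain ⟨hab, hc'⟩ := List.isChain_cons_cons.1 hc
    rw [List.map_cons, List.prod_cons, ih b hc', twinNum₃_eq, neg_mul_neg, vecMulVec_mul_vecMulVec',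
      twinAxis₃_dotProduct_of_ne a b hab, neg_one_smul, List.getLast_cons_cons]

/-- Hence NO ENTRY of such a product vanishes mod `3` … -/
theorem prod_map_twinNum₃_apply_ne_zero {w : List (Fin 4)} (hw : w ≠ []) (hc : w.IsChain (· ≠ ·))
    (i j : Fin 3) : (w.map twinNum₃).prod i j ≠ 0 := by
  obtain ⟨a, w, rfl⟩ := List.exists_cons_of_ne_nil hw
  rw [prod_map_twinNum₃_cons a w hc, Matrix.neg_apply, vecMulVec_apply, neg_ne_zero]
  exact mul_ne_zero (twinAxis₃_apply_ne_zero _ _) (twinAxis₃_apply_ne_zero _ _)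

/-- … i.e. no entry of `(3R_{a₁})⋯(3R_{aₙ})` is divisible by `3` for a non-backtracking word of length `n ≥ 1`. -/
theorem three_not_dvd_prod_map_twinNum {w : List (Fin 4)} (hw : w ≠ []) (hc : w.IsChain (· ≠ ·))
    (i j : Fin 3) : ¬ (3 : ℤ) ∣ (w.map twinNum).prod i j := by
  intro h
  apply prod_map_twinNum₃_apply_ne_zero hw hc i j
  have hmap : (w.map twinNum₃).prod = (Int.castRingHom (ZMod 3)).mapMatrix (w.map twinNum).prod := by
    rw [map_list_prod, List.map_map]
    rfl
  rw [hmap, RingHom.mapMatrix_apply, Matrix.map_apply]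
  exact (ZMod.intCast_zmod_eq_zero_iff_dvd _ 3).2 (by exact_mod_cast h)

/-! ### (T3) Non-integrality, the EDGE LEMMA and the TREE THEOREM -/

/-- The product of twin operations along a word is `3^{−n}` times the product of the numerators. -/
theorem prod_map_twinRot (w : List (Fin 4)) :
    (w.map twinRot).prod = (1 / 3 : ℚ) ^ w.length • (Int.castRingHom ℚ).mapMatrix (w.map twinNum).prod := by
  induction w with
  | nil => simp
  | cons a w ih =>
    rw [List.map_cons, List.prod_cons, ih, twinRot, smul_mul_smul_comm, ← map_mul, List.map_cons,
      List.prod_cons, List.length_cons, pow_succ']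

/-- The INTEGRAL rational `3 × 3` matrices: the image of `Matrix (Fin 3) (Fin 3) ℤ` in `Matrix (Fin 3) (Fin 3) ℚ`.
The proper cubic point group `O` — indeed the whole hyperoctahedral group of signed permutation matrices,
`GL₃(ℤ) ∩ O(3)` — consists of integral matrices, so «the orientation walk closes» (the product of the twin operations
lies in `O`) implies «the product is integral», which is all the edge lemma uses. -/
def integralMatrices : Set (Matrix (Fin 3) (Fin 3) ℚ) :=
  Set.range (Int.castRingHom ℚ).mapMatrix

/-- Integer matrices (in particular the `48` signed permutation matrices of the cubic point group) are integral. -/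
theorem mapMatrix_mem_integralMatrices (N : Matrix (Fin 3) (Fin 3) ℤ) :
    (Int.castRingHom ℚ).mapMatrix N ∈ integralMatrices :=
  ⟨N, rfl⟩

/-- The identity is integral (the trivial closed walk). -/
theorem one_mem_integralMatrices : (1 : Matrix (Fin 3) (Fin 3) ℚ) ∈ integralMatrices :=
  ⟨1, map_one _⟩

/-- ★ NON-INTEGRALITY. The product of the twin operations along a NON-BACKTRACKING word of length `n ≥ 1` is never
an integral matrix (its entries have denominator exactly `3^n`). -/
theorem prod_map_twinRot_not_mem {w : List (Fin 4)} (hw : w ≠ []) (hc : w.IsChain (· ≠ ·)) :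
    (w.map twinRot).prod ∉ integralMatrices := by
  rintro ⟨N, hN⟩
  have hz := congr_fun (congr_fun hN 0) 0
  rw [prod_map_twinRot] at hz
  simp only [Matrix.smul_apply, RingHom.mapMatrix_apply, Matrix.map_apply, smul_eq_mul, eq_intCast] at hz
  have hpow : (3 : ℚ) ^ w.length * (1 / 3 : ℚ) ^ w.length = 1 := by
    rw [← mul_pow]; norm_num
  have h3 : (w.map twinNum).prod 0 0 = 3 ^ w.length * N 0 0 := by
    have h' : (((w.map twinNum).prod 0 0 : ℤ) : ℚ) = (3 : ℚ) ^ w.length * ((N 0 0 : ℤ) : ℚ) := by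
      rw [hz, ← mul_assoc, hpow, one_mul]
    exact_mod_cast h'
  refine three_not_dvd_prod_map_twinNum hw hc 0 0 ?_
  rw [h3]
  have hn : w.length ≠ 0 := by
    have := List.length_pos_of_ne_nil hw
    omega
  exact Dvd.dvd.mul_right (dvd_pow_self 3 hn) (N 0 0)

/-- ★★ THE EDGE LEMMA (Σ3ⁿ BACKTRACKING). If the product of coherent-twin operations along a nonempty axis word is
integral — in particular if the orientation walk CLOSES modulo the cubic point group — then two CONSECUTIVE letters
coincide: the walk crosses the same twin plane system twice in a row through one grain (a twin lamella /
backtracking step).  Contrapositive: a closed loop in defect-free Σ3-twinned matter cannot cross `n ≥ 1` coherent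
twin planes transversally with no two consecutive crossings parallel — twin planes cannot END, and junction lines of
non-parallel coherent twins need a further (non-Σ3) boundary. -/
theorem exists_adjacent_eq_of_prod_mem {w : List (Fin 4)} (hw : w ≠ [])
    (hI : (w.map twinRot).prod ∈ integralMatrices) :
    ∃ (i : ℕ) (h : i + 1 < w.length), w[i] = w[i + 1] := by
  by_contra hne
  push Not at hne
  exact prod_map_twinRot_not_mem hw (List.isChain_iff_getElem.2 fun i h => hne i h) hI

/-- The form (N𝄪)'s proof calls: a walk whose twin-operation product is a LATTICE SYMMETRY `N` (an integer matrix — every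
element of the cubic point group is one) backtracks. -/
theorem exists_adjacent_eq_of_prod_eq_mapMatrix {w : List (Fin 4)} (hw : w ≠ []) (N : Matrix (Fin 3) (Fin 3) ℤ)
    (h : (w.map twinRot).prod = (Int.castRingHom ℚ).mapMatrix N) :
    ∃ (i : ℕ) (h : i + 1 < w.length), w[i] = w[i + 1] :=
  exists_adjacent_eq_of_prod_mem hw (h ▸ mapMatrix_mem_integralMatrices N)

/-- The single twin operation is not integral: ONE coherent twin plane cannot terminate inside defect-free matter
(a loop linking its edge would cross it exactly once). -/
theorem twinRot_not_mem (a : Fin 4) : twinRot a ∉ integralMatrices := by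
  simpa using prod_map_twinRot_not_mem (w := [a]) (List.cons_ne_nil a []) (List.isChain_singleton a)

/-- Two twin operations of DIFFERENT systems never compose to a lattice symmetry (`Σ3·Σ3' = Σ9`): two crossing
coherent twin planes of different systems force a third, non-Σ3 boundary at their junction. -/
theorem twinRot_mul_twinRot_not_mem {a b : Fin 4} (hab : a ≠ b) :
    twinRot a * twinRot b ∉ integralMatrices := by
  simpa using prod_map_twinRot_not_mem (w := [a, b]) (List.cons_ne_nil a [b])
    (List.isChain_cons_cons.2 ⟨hab, List.isChain_singleton b⟩)

/-- Walking a word backwards undoes it: `R_{aₙ}⋯R_{a₁} · R_{a₁}⋯R_{aₙ} = 1`. -/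
theorem prod_map_twinRot_reverse_mul (w : List (Fin 4)) :
    (w.reverse.map twinRot).prod * (w.map twinRot).prod = 1 := by
  induction w with
  | nil => simp
  | cons a w ih =>
    simp only [List.reverse_cons, List.map_append, List.map_cons, List.map_nil, List.prod_append,
      List.prod_cons, List.prod_nil, mul_one]
    rw [mul_assoc, ← mul_assoc (twinRot a), twinRot_mul_self, one_mul]
    exact ih

/-- Reversal preserves non-backtracking. -/
theorem isChain_ne_reverse {w : List (Fin 4)} (hc : w.IsChain (· ≠ ·)) : w.reverse.IsChain (· ≠ ·) :=
  List.isChain_reverse.2 (hc.imp fun _ _ h => Ne.symm h)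

/-- Core of the tree theorem: if `R_{w₁}⁻¹ R_{w₂}` is integral for non-backtracking `w₁, w₂` then `w₁ = w₂`. -/
theorem eq_of_reverse_prod_mul_prod_mem :
    ∀ {w₁ w₂ : List (Fin 4)}, w₁.IsChain (· ≠ ·) → w₂.IsChain (· ≠ ·) →
      (w₁.reverse.map twinRot).prod * (w₂.map twinRot).prod ∈ integralMatrices → w₁ = w₂
  | [], w₂, _, h₂, hI => by
    by_contra hne
    refine prod_map_twinRot_not_mem (Ne.symm hne) h₂ ?_
    simpa using hI
  | a :: w₁, [], h₁, _, hI => by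
    exfalso
    refine prod_map_twinRot_not_mem (w := (a :: w₁).reverse) (by simp) (isChain_ne_reverse h₁) ?_
    simpa using hI
  | a :: w₁, b :: w₂, h₁, h₂, hI => by
    by_cases hab : a = b
    · subst hab
      have hI' : (w₁.reverse.map twinRot).prod * (w₂.map twinRot).prod ∈ integralMatrices := by
        have : ((a :: w₁).reverse.map twinRot).prod * ((a :: w₂).map twinRot).prod
            = (w₁.reverse.map twinRot).prod * (w₂.map twinRot).prod := by
          simp only [List.reverse_cons, List.map_append, List.map_cons, List.map_nil, List.prod_append,
            List.prod_cons, List.prod_nil, mul_one]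
          rw [mul_assoc, ← mul_assoc (twinRot a), twinRot_mul_self, one_mul]
        rw [← this]; exact hI
      rw [eq_of_reverse_prod_mul_prod_mem (w₁ := w₁) (w₂ := w₂) h₁.tail h₂.tail hI']
    · exfalso
      have hw : ((a :: w₁).reverse ++ (b :: w₂)).IsChain (· ≠ ·) := by
        rw [List.reverse_cons, List.append_assoc, List.singleton_append]
        exact List.isChain_append_cons_cons.2 ⟨by simpa using isChain_ne_reverse h₁, hab, h₂⟩
      refine prod_map_twinRot_not_mem (w := (a :: w₁).reverse ++ (b :: w₂)) (by simp) hw ?_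
      rwa [List.map_append, List.prod_append]

/-- ★★ THE TREE THEOREM (injectivity of the Σ3ⁿ labelling). Two non-backtracking axis words leading from the reference
grain to the same orientation class — `R_{w₁} · M = R_{w₂}` with `M` integral (e.g. a cubic symmetry) — are EQUAL, and
then `M = 1`: the orientation classes reachable through coherent twinning form a `4·3^{n−1}`-branching TREE
(the Cayley tree of `(ℤ/2)^{*4}`), each class labelled by a unique reduced word. -/
theorem eq_of_prod_map_twinRot_mul_eq {w₁ w₂ : List (Fin 4)} (h₁ : w₁.IsChain (· ≠ ·)) (h₂ : w₂.IsChain (· ≠ ·))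
    {M : Matrix (Fin 3) (Fin 3) ℚ} (hM : M ∈ integralMatrices)
    (h : (w₁.map twinRot).prod * M = (w₂.map twinRot).prod) : w₁ = w₂ ∧ M = 1 := by
  have hM' : (w₁.reverse.map twinRot).prod * (w₂.map twinRot).prod = M := by
    rw [← h, ← mul_assoc, prod_map_twinRot_reverse_mul, one_mul]
  have hw : w₁ = w₂ := eq_of_reverse_prod_mul_prod_mem h₁ h₂ (by rw [hM']; exact hM)
  subst hw
  exact ⟨rfl, by rw [← hM', prod_map_twinRot_reverse_mul]⟩

end TwinTree

end Summit.AtomisticToContinuum.Crystallization.Theorems.ChargedEnergyGapChartDial
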